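import Literature.NumberTheory.Automorphic.UnitaryGroupUnipotentRationalBorelTwo
import Literature.NumberTheory.Automorphic.UnitaryGroupKernelClassUnipotent
import Literature.NumberTheory.Automorphic.UnitaryGroupTruncatedTraceClassKeyedSocketGlue
import HarnessLib

/-!
# The central socket of the trace formula for `U(J₂)`, CLOSED on a finite set of classes from a per-key row:
# `Σ_{i ∈ S, i central} p_i(0) = Σ_i 𝔟(ζ_i)`
(Rogawski, *Automorphic Representations of Unitary Groups in Three Variables* (1990), Prop. 7.3.1 (p. 97): for `G = U(2)`, `U(2) × U(1)`
the term of the unipotent class of a central `γ` is the sum of (a)–(d); Arthur, *The trace formula in invariant form*, Ann. of Math. 114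
(1981), Prop. 2.3: `J^T_𝔬(f)` is a polynomial in `log T` and `J_𝔬(f)` its constant term.)

Topic `NumberTheory/Automorphic`; namespace `Literature.NumberTheory.Automorphic.UnitaryGroup`. THEOREMS ONLY over accepted tree modules
(no definition, no named fact, no instance, no notation, no `sorry`). H-side item (σ-u) «FINSET CLOSER OF THE CENTRAL SOCKET at `N = 2`» of
the T1-qs LAW 5 road of `Cruxes/H413/Lines/F0_T1InnerFormTraceIdentity.lean` (cell `pub/hodgecm-mathlib`, crux H413; census `CENSUS-LAWS-Hside`
§3; desk 14:52:31Z (b)) — the `N = 2` twin of ★ `UnitaryGroupCentralSocketClosed`, written HYPOTHESES-FIRST IN THE ROW so that the bookkeeping is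
independent of the analytic assembly: the socket of ★-pending `UnitaryGroupArthurTraceTwoSockets` writes `J(f)` with a sum over the central
refined indices `i = (((X − z)²) ⊗ 𝔸_E, true)`, `z ∈ E¹` (★ `sum_filter_meetsBorel_eq_sum_central_add_sum_hyperbolic_two`); GIVEN a per-key row
`J^T_{i(ζ)}(f) = 𝔞(ζ)·log T + 𝔟(ζ)` for `T ≫ 0` (the conclusion of `truncatedTraceClass_central_eq_linear_of_parts_two` ∕ its `_cm` pin, with the
constants gathered into two functions `𝔞, 𝔟` of the key `ζ ∈ E¹`), ★ KEYED GLUE `exists_rep_sum_classPolynomial_eval_zero_eq` closes the socket.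

* §1 `exists_ratOne_of_mem_filter_central_two` — a class of the central filter has a key `ζ ∈ E¹` with `i = (((X − ζ)²) ⊗ 𝔸_E, true)`;
  `borelRefine_charpoly_eq_central_two_iff` — the FIBRE LETTER of the socket's refined class map `cl♭` at the central class: the flag is automatic
  (★ `forall_exists_conj_mem_arithmeticBorel_of_charpoly_eq_sq_two`, Rogawski Prop. 3.9.1 at `N = 2`).
* §2 **`exists_rep_sum_filter_central_classPolynomial_eval_zero_two`** — for a finite set `S` of refined indices with class polynomials `P`
  (`hP`, the socket's letter) and a per-key row `hrow`: keys `zrep i ∈ E¹` on the central filter with `(((X − zrep i)²) ⊗ 𝔸_E, true) = i`,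
  `P i = C 𝔞(zrep i) * X + C 𝔟(zrep i)` and **`Σ_{S.filter central} (P i).eval 0 = Σ_{S.filter central} 𝔟(zrep i)`**.

## References
* J. D. Rogawski, *Automorphic Representations of Unitary Groups in Three Variables*, Annals of Mathematics Studies 123 (1990), Prop. 7.3.1 (p. 97),
  §2.2–2.3 (pp. 13–14), Prop. 3.9.1 (p. 32) [Rogawski1990].
* J. Arthur, *The trace formula in invariant form*, Ann. of Math. 114 (1981), Prop. 2.3 [Arthur1981TraceFormulaInvariantForm].
-/

set_option autoImplicit false

noncomputable section

open MeasureTheory MeasureTheory.Measure NumberField IsDedekindDomain Set Polynomial Function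
open scoped ENNReal NNReal MatrixGroups Classical

namespace Literature.NumberTheory.Automorphic

namespace UnitaryGroup

variable {F E : Type} [Field F] [NumberField F] [Field E] [NumberField E] [Algebra F E] {c : E ≃ₐ[F] E}

/-! ## §1 Keys of the central classes of `U(J₂)` and the fibre letter of the refined class map -/

section Key

omit [NumberField F] in
/-- **EVERY CLASS OF THE CENTRAL SOCKET OF `U(J₂)` HAS A KEY IN `E¹`.** If the refined index `i = (p, flag)` lies in the central filter of the
`N = 2` socket (`flag = true`, `p = (X − z)² ⊗ 𝔸_E` with `c z · z = 1`, ★ `sum_filter_meetsBorel_eq_sum_central_add_sum_hyperbolic_two`), then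
`z = ζ ∈ E¹ = ratOne F E c` and `i = (((X − ζ)²) ⊗ 𝔸_E, true)` — the `hpq` letter of ★ KEYED GLUE. [cite: Rogawski1990, §2.2 (p. 13)]
[cite: Rogawski1990, Prop. 3.9.1 (p. 32)] -/
theorem exists_ratOne_of_mem_filter_central_two (S : Finset ((AdeleRing (𝓞 E) E)[X] × Bool))
    (i : (AdeleRing (𝓞 E) E)[X] × Bool) (_hi : i ∈ S)
    (hpi : (fun i : (AdeleRing (𝓞 E) E)[X] × Bool => i.2 = true ∧
        ∃ z : Eˣ, c (z : E) * (z : E) = 1 ∧ i.1 = ((X - C (z : E)) ^ 2).map (algebraMap E (AdeleRing (𝓞 E) E))) i) :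
    ∃ ζ : ratOne F E c, True ∧
      ((((X - C (((ζ : Eˣ) : E))) ^ 2).map (algebraMap E (AdeleRing (𝓞 E) E))), true) = i := by
  obtain ⟨hi2, z, hz, hi1⟩ := hpi
  refine ⟨⟨z, (mem_ratOne_iff F E c z).2 (by rw [RingHom.coe_coe]; exact hz)⟩, trivial, ?_⟩
  exact Prod.ext hi1.symm hi2.symm

/-- **THE FIBRE LETTER `hcl` OF THE SOCKET'S CLASS MAP AT THE CENTRAL CLASS OF `U(J₂)`**: for the Borel-refined characteristic-polynomial class
map `cl♭ γ = (charpoly γ, [∃ δ ∈ G(F), δ γ δ⁻¹ ∈ B(F)])` and `ζ ∈ E¹`, `cl♭ γ = (((X − ζ)²).map, true) ↔ charpoly γ = ((X − ζ)²).map` — the flag is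
automatic because EVERY rational element with characteristic polynomial `(X − ζ)²` is `G(F)`-conjugate into `B(F)` (★
`forall_exists_conj_mem_arithmeticBorel_of_charpoly_eq_sq_two`, Rogawski's Prop. 3.9.1 at `N = 2`). The `N = 2` twin of ★
`borelRefine_charpoly_eq_central_iff`. [cite: Rogawski1990, Prop. 3.9.1 (p. 32)] [cite: Rogawski1990, §2.2 (p. 13)] -/
theorem borelRefine_charpoly_eq_central_two_iff (ζ : ratOne F E c) (γ : (quasiSplit F E c 2).arithmeticSubgroup) :
    (fun γ : (quasiSplit F E c 2).arithmeticSubgroup =>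
        (((adelicVal F E c 2 _ (γ : (quasiSplit F E c 2).Adelic) : GL (Fin 2) (AdeleRing (𝓞 E) E)) :
            Matrix (Fin 2) (Fin 2) (AdeleRing (𝓞 E) E)).charpoly,
          decide (∃ δ : (quasiSplit F E c 2).arithmeticSubgroup, δ * γ * δ⁻¹ ∈ arithmeticBorel F E c 2))) γ =
        (((X - C ((ζ : Eˣ) : E)) ^ 2).map (algebraMap E (AdeleRing (𝓞 E) E)), true) ↔
      ((adelicVal F E c 2 _ (γ : (quasiSplit F E c 2).Adelic) : GL (Fin 2) (AdeleRing (𝓞 E) E)) :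
          Matrix (Fin 2) (Fin 2) (AdeleRing (𝓞 E) E)).charpoly =
        ((X - C ((ζ : Eˣ) : E)) ^ 2).map (algebraMap E (AdeleRing (𝓞 E) E)) := by
  simp only [Prod.mk.injEq, decide_eq_true_eq]
  exact ⟨fun h => h.1, fun h => ⟨h, forall_exists_conj_mem_arithmeticBorel_of_charpoly_eq_sq_two (conj_mul_self_of_ratOne ζ) γ h⟩⟩

end Key

/-! ## §2 The central socket closed from a per-key row -/

section Closer

variable [MeasurableSpace (adelicUnipotent F E c 2)]
  {μ : Measure (quasiSplit F E c 2).automorphicQuotient}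
  {ν : Measure (adelicUnipotent F E c 2)} {𝓕 : Set (adelicUnipotent F E c 2)}
  {f : (quasiSplit F E c 2).Adelic → ℂ}

/-- **THE CENTRAL SOCKET OF `U(J₂)`, CLOSED ON A FINITE SET OF CLASSES FROM A PER-KEY ROW** [Rogawski1990, Prop. 7.3.1 (p. 97)]. For an automorphic
measure `μ`, Haar data `ν, 𝓕` of `N(𝔸_F)`, `f`, a finite set `S` of refined indices with class polynomials `P` such that
`J^T_i(f) = P_i(log T)` for `T ≫ 0` (`i ∈ S`; the socket's letter `hP`, class map = the Borel-refined characteristic polynomial `cl♭`), and a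
PER-KEY ROW `hrow`: for every `ζ ∈ E¹`, `J^T_{i(ζ)}(f) = 𝔞(ζ)·log T + 𝔟(ζ)` for `T ≫ 0` at `i(ζ) = (((X − ζ)²) ⊗ 𝔸_E, true)` (the conclusion of the
(σ-u) per-class Tate assembly `truncatedTraceClass_central_eq_linear_of_parts_two` with its constants gathered into `𝔞, 𝔟 : E¹ → ℂ`): there are
keys `zrep i ∈ E¹` on the central filter with `(((X − zrep i)²) ⊗ 𝔸_E, true) = i`, the class polynomials are `P i = C 𝔞(zrep i) * X + C 𝔟(zrep i)`,
and **`Σ_{S.filter central} P_i(0) = Σ_{S.filter central} 𝔟(zrep i)`** — ★ KEYED GLUE `exists_rep_sum_classPolynomial_eval_zero_eq` at the key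
type `E¹`, `hpq` = §1. This is the `closerC`-shaped hypothesis of the `N = 2` sockets skeleton at `κc := ratOne F E c`, `Bc := 𝔟`.
[cite: Rogawski1990, Prop. 7.3.1 (p. 97)] [cite: Arthur1981TraceFormulaInvariantForm, Prop. 2.3] -/
theorem exists_rep_sum_filter_central_classPolynomial_eval_zero_two {𝔞 𝔟 : ratOne F E c → ℂ}
    (hrow : ∀ ζ : ratOne F E c, ∃ T₁ : ℝ≥0, ∀ T : ℝ≥0, T₁ < T →
      truncatedTraceClass μ ν 𝓕 T
          (fun γ : (quasiSplit F E c 2).arithmeticSubgroup =>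
            (((adelicVal F E c 2 _ (γ : (quasiSplit F E c 2).Adelic) : GL (Fin 2) (AdeleRing (𝓞 E) E)) :
                Matrix (Fin 2) (Fin 2) (AdeleRing (𝓞 E) E)).charpoly,
              decide (∃ δ : (quasiSplit F E c 2).arithmeticSubgroup, δ * γ * δ⁻¹ ∈ arithmeticBorel F E c 2)))
          ((((X - C (((ζ : Eˣ) : E))) ^ 2).map (algebraMap E (AdeleRing (𝓞 E) E))), true) f =
        𝔞 ζ * ((Real.log (T : ℝ) : ℝ) : ℂ) + 𝔟 ζ)
    (S : Finset ((AdeleRing (𝓞 E) E)[X] × Bool)) (P : (AdeleRing (𝓞 E) E)[X] × Bool → ℂ[X])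
    (hP : ∀ i ∈ S, ∃ T₀ : ℝ≥0, ∀ T : ℝ≥0, T₀ < T →
      truncatedTraceClass μ ν 𝓕 T
          (fun γ : (quasiSplit F E c 2).arithmeticSubgroup =>
            (((adelicVal F E c 2 _ (γ : (quasiSplit F E c 2).Adelic) : GL (Fin 2) (AdeleRing (𝓞 E) E)) :
                Matrix (Fin 2) (Fin 2) (AdeleRing (𝓞 E) E)).charpoly,
              decide (∃ δ : (quasiSplit F E c 2).arithmeticSubgroup, δ * γ * δ⁻¹ ∈ arithmeticBorel F E c 2)))
          i f = (P i).eval ((Real.log (T : ℝ) : ℝ) : ℂ)) :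
    ∃ zrep : (AdeleRing (𝓞 E) E)[X] × Bool → ratOne F E c,
      (∀ i ∈ S.filter (fun i : (AdeleRing (𝓞 E) E)[X] × Bool => i.2 = true ∧
        ∃ z : Eˣ, c (z : E) * (z : E) = 1 ∧ i.1 = ((X - C (z : E)) ^ 2).map (algebraMap E (AdeleRing (𝓞 E) E))),
        ((((X - C (((zrep i : Eˣ) : E))) ^ 2).map (algebraMap E (AdeleRing (𝓞 E) E))), true) = i) ∧
      (∀ i ∈ S.filter (fun i : (AdeleRing (𝓞 E) E)[X] × Bool => i.2 = true ∧
        ∃ z : Eˣ, c (z : E) * (z : E) = 1 ∧ i.1 = ((X - C (z : E)) ^ 2).map (algebraMap E (AdeleRing (𝓞 E) E))),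
        P i = C (𝔞 (zrep i)) * X + C (𝔟 (zrep i))) ∧
      ∑ i ∈ S.filter (fun i : (AdeleRing (𝓞 E) E)[X] × Bool => i.2 = true ∧
        ∃ z : Eˣ, c (z : E) * (z : E) = 1 ∧ i.1 = ((X - C (z : E)) ^ 2).map (algebraMap E (AdeleRing (𝓞 E) E))),
          (P i).eval 0 =
        ∑ i ∈ S.filter (fun i : (AdeleRing (𝓞 E) E)[X] × Bool => i.2 = true ∧
          ∃ z : Eˣ, c (z : E) * (z : E) = 1 ∧ i.1 = ((X - C (z : E)) ^ 2).map (algebraMap E (AdeleRing (𝓞 E) E))),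
            𝔟 (zrep i) := by
  obtain ⟨rep, hkey, hlin, hsum⟩ := exists_rep_sum_classPolynomial_eval_zero_eq S
    (fun i : (AdeleRing (𝓞 E) E)[X] × Bool => i.2 = true ∧
        ∃ z : Eˣ, c (z : E) * (z : E) = 1 ∧ i.1 = ((X - C (z : E)) ^ 2).map (algebraMap E (AdeleRing (𝓞 E) E)))
    (fun ζ : ratOne F E c => ((((X - C (((ζ : Eˣ) : E))) ^ 2).map (algebraMap E (AdeleRing (𝓞 E) E))), true))
    (fun _ => True) (fun i hi hpi => exists_ratOne_of_mem_filter_central_two S i hi hpi)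
    (a := 𝔞) (b := 𝔟) (fun ζ _ => hrow ζ) P hP
  exact ⟨rep, fun i hi => (hkey i hi).2, hlin, hsum⟩

end Closer

end UnitaryGroup

end Literature.NumberTheory.Automorphic

end
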